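import Summits.ResolutionOfSingularities.ResolutionOfSingularities.Theorems.HomologicalConductorNoZenoL1wCoreCloserUnconditional
import Summits.ResolutionOfSingularities.ResolutionOfSingularities.Theorems.HomologicalConductorNoZenoStageRational
import Summits.ResolutionOfSingularities.ResolutionOfSingularities.Theorems.HomologicalConductorNoZenoRLipman165
import HarnessLib

/-!
# Crux `NoZenoR` (stmt-ResolutionOfSingularities-19943) — nodes of the W4.4 line made less conditional by
# `Lipman1969_1_2_B_holds`: the singular sandwiched stage is RATIONAL (unconditional), the minimal resolution of a stage
# modulo (4.1) alone, and the slot-5 (B1) closer `l1wCore` modulo FIVE prints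

Route `ResolutionOfSingularities/HomologicalConductor` (cell decomp-res, hand leafhand-res-homologicalconduct-18 g0).
OURS: AI-written bookkeeping over tree theorems, weaker than expert review; nothing here is a statement of the manuscript
under review (Hironaka 2017).  SUPPORT level, counted 0.  Def-free, no new named facts.

With Lipman (1.2), (13.1) b), (13.1) d), (16.5) now tree theorems (`Lipman12B.Lipman1969_1_2_holds`,
`Lipman12B.Lipman1969_13_1_b_rat_holds`, `Lipman12B.Lipman1969_13_1_d_rat_holds`, `Lipman12B.Lipman1969_16_5_holds` — this hand),
three fact-parametric nodes of the line lose binders: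

* `SandwichCluster.hasRationalSingularity_tower_holds` — **G0a UNCONDITIONAL**: for a sandwich context `ctx : SandwichCtx O A R m₀`
  and `m ≥ m₀ + 1`, a SINGULAR stage `T_m = tower O A m` has a RATIONAL singularity (was modulo `Lipman1969_1_2`);
* `SandwichCluster.minResolutionExists_of_4_1` — the registered v18 stub text `stub_minResolutionExists` modulo Lipman (4.1)
  ALONE (was modulo (1.2) and (4.1), with an idle CJS binder);
* `ExcCount.l1wCore_of_printedFacts5` — the slot-5 (B1) closer (every sandwiched step above a rational stage is regular or
  rational with fewer split exceptional curves) modulo the FIVE prints `Lipman1969_4_1`, `Lipman1969_12_1_i`,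
  `Lipman1969_12_1_ii`, `Lipman1969_27_1_reg_rat`, `Lipman1969_27_3_rat` (was nine: (13.1) b), d), (1.2), (16.5) fed).

No crux or summit statement is proved here.
-/

noncomputable section

-- single-problem summit: the doubled namespace component `ResolutionOfSingularities` is forced
set_option linter.dupNamespace false

open IsLocalRing
open CategoryTheory AlgebraicGeometry
open Literature.AlgebraicGeometry Literature.AlgebraicGeometry.Resolution

namespace Summit.ResolutionOfSingularities.ResolutionOfSingularities.Theorems.NoZeno.SandwichCluster

open Summit.ResolutionOfSingularities.ResolutionOfSingularities.Theorems.NoZeno.Birth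

variable {k K : Type} [Field k] [Field K] [Algebra k K]

/-- **G0a, UNCONDITIONAL. The singular sandwiched stage has a RATIONAL singularity**: for `ctx : SandwichCtx O A R m₀`,
`m ≥ m₀ + 1` and `T_m = tower O A m` singular, `HasRationalSingularity T_m` — `hasRationalSingularity_tower` with Lipman (1.2)
supplied by `Lipman12B.Lipman1969_1_2_holds`. [cite: Lipman1969, Proposition (1.2) 1) (p. 199)] -/
theorem hasRationalSingularity_tower_holds (O : ValuationSubring K) (A R : Subalgebra k K) (m₀ : ℕ)
    (ctx : SandwichCtx O A R m₀) (m : ℕ) (hm : m₀ + 1 ≤ m) (hsing : ¬ IsRegularLocalRing ↥(tower O A m)) :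
    HasRationalSingularity ↥(tower O A m) :=
  hasRationalSingularity_tower Lipman12B.Lipman1969_1_2_holds O A R m₀ ctx m hm hsing

/-- **The singular sandwiched stage has a minimal resolution, modulo Lipman (4.1) ALONE** (the registered v18 stub text
`stub_minResolutionExists` without its (1.2) and CJS binders). [cite: Lipman1969, Theorem (4.1) (p. 204)] -/
theorem minResolutionExists_of_4_1 (h41 : Lipman1969_4_1.{0})
    (p : ℕ) (hp : p.Prime) (k K : Type) [Field k] [CharP k p] [Field K] [Algebra k K]
    (O : ValuationSubring K) (A R : Subalgebra k K) (m₀ : ℕ) (ctx : SandwichCtx O A R m₀) (m : ℕ)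
    (hm : m₀ + 1 ≤ m) (hsing : ¬ IsRegularLocalRing ↥(tower O A m)) :
    ∃ (X : AlgebraicGeometry.Scheme.{0}) (π : X ⟶ AlgebraicGeometry.Spec (CommRingCat.of ↥(tower O A m))),
      Literature.AlgebraicGeometry.Resolution.IsMinimalResolution π :=
  minResolutionExists_of_lipman Lipman12B.Lipman1969_1_2_holds h41 p hp k K O A R m₀ ctx m hm hsing

end Summit.ResolutionOfSingularities.ResolutionOfSingularities.Theorems.NoZeno.SandwichCluster

namespace Summit.ResolutionOfSingularities.ResolutionOfSingularities.Theorems.NoZeno.ExcCount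

open Summit.ResolutionOfSingularities.ResolutionOfSingularities.Theorems.NoZeno.Birth (nrm)
open Summit.ResolutionOfSingularities.ResolutionOfSingularities.Theorems.NoZeno.SandwichCluster
open Summit.ResolutionOfSingularities.ResolutionOfSingularities.Theorems.NoZeno.SandwichCluster.Parasite
  (locPrime isLocalRing_locPrime)

/-- **The slot-5 (B1) closer `l1wCore` modulo FIVE prints** — `l1wCore_of_printedFacts9` with (13.1) b), (13.1) d), (1.2), (16.5)
supplied by the tree theorems of `Lipman12B`: for a two-dimensional normal local ring `locPrime T P` (essentially of finite type
over `k`) with a rational singularity and at most `N` split exceptional curves, every local ring `D'` of the normalised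
sandwiched blow-up of a separating `x ∈ C` dominating it is regular, or rational with at most `N − 1` split exceptional curves.
[cite: Lipman1969, Theorem (4.1) (p. 204), Theorem (12.1) (p. 220), Theorem (27.1) (p. 275), Corollary (27.3) (p. 277)] -/
theorem l1wCore_of_printedFacts5
    (h41 : Lipman1969_4_1.{0}) (h121i : Lipman1969_12_1_i.{0}) (h121ii : Lipman1969_12_1_ii.{0})
    (h271 : Lipman1969_27_1_reg_rat.{0}) (h273 : Lipman1969_27_3_rat.{0}) :
    ∀ (k K : Type) [Field k] [Field K] [Algebra k K] (T : Subalgebra k K) (P : Ideal ↥T) (hP : P.IsPrime),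
    Algebra.EssFiniteType k ↥T → IsIntegrallyClosed ↥T → IsFractionRing ↥T K →
    ringKrullDim ↥(locPrime T P hP) = 2 →
    HasRationalSingularity ↥(locPrime T P hP) →
    ∀ (N : ℕ), @HasSplitExcCurveCountLE ↥(locPrime T P hP) _ (isLocalRing_locPrime T P hP) N →
    ∀ (C : Set K), C ⊆ (T : Set K) →
      (Ideal.span {d : ↥(locPrime T P hP) | (d : K) ∈ C}).radical =
        @maximalIdeal ↥(locPrime T P hP) _ (isLocalRing_locPrime T P hP) →
      @IsSepX1Sandwiched ↥(locPrime T P hP) _ (isLocalRing_locPrime T P hP)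
        (Ideal.span {d : ↥(locPrime T P hP) | (d : K) ∈ C}) →
    ∀ (x : K), x ∈ C → x ≠ 0 →
    ∀ (B : Subalgebra k K),
      B = Algebra.adjoin k ((locPrime T P hP : Set K) ∪ {y : K | ∃ c ∈ C, y = c * x⁻¹}) →
    ∀ (𝔮 : Ideal ↥(nrm B)) (h𝔮 : 𝔮.IsPrime) (D' : Subring K) (hD' : IsLocalRing ↥D'),
      locPrime (nrm B) 𝔮 h𝔮 = D' → (locPrime T P hP : Set K) ⊆ D' →
      ringKrullDim ↥D' = 2 → IsIntegrallyClosed ↥D' →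
      IsRegularLocalRing ↥D' ∨ (HasRationalSingularity ↥D' ∧ @HasSplitExcCurveCountLE ↥D' _ hD' (N - 1)) :=
  l1wCore_of_printedFacts9 Lipman12B.Lipman1969_13_1_b_rat_holds.{0} Lipman12B.Lipman1969_13_1_d_rat_holds.{0}
    Lipman12B.Lipman1969_1_2_holds h41 h121i h121ii Lipman12B.Lipman1969_16_5_holds.{0} h271 h273

end Summit.ResolutionOfSingularities.ResolutionOfSingularities.Theorems.NoZeno.ExcCount

end
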